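import Summits.MatrixMultiplication.OmegaCensus.STPPKernelListerKit

/-!
# ω-census (abelian STPP census): kernel lister — assembly kit 2: from an arbitrary STPP family to a minimal beating realisable pattern (kernel)

HONEST FRAMING (pub-omega census; verbatim): lottery ticket; floor = certified bounds/negative ranges.
Census STRUCTURE (seat pub-omega-stpp-2 gen 29, 2026-08-29), family (b2).  Nothing here is progress on `ω`.

(4) `realizable_of_isSTPP`: an arbitrary STPP family `(A,B,C) : Fin m → Finset H` realises the list of the card triples of its blocks with NON-EMPTY sets,
with the same total volume.  (3) `exists_minimal_bad`: if some realisable pattern beats (`Σ vol > n`) then some realisable pattern is BAD (beating and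
minimal: no single shrink beats) — by least total volume, using the single-shrink construction `exists_realizable_shrink` (decrement the `A`-size of a
block, or delete a block with `|A| = 1`; the other coordinates via the role rotation).
-/

open Finset

namespace Summit.MatrixMultiplication.OmegaCensus.KLister

open Literature.Computability.AlgebraicComplexity

variable {H : Type*} [AddCommGroup H]

/-! ## (4) From a family to a realisable pattern -/

/-- A sum over a list vanishing off a predicate is the sum over the filtered list. [folklore] -/
theorem sum_map_eq_sum_map_filter {ι : Type*} (l : List ι) (p : ι → Bool) (f : ι → ℕ) (hf : ∀ x ∈ l, p x = false → f x = 0) :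
    (l.map f).sum = ((l.filter p).map f).sum := by
  induction l with
  | nil => rfl
  | cons x l ih =>
    have ih' := ih (fun y hy => hf y (List.mem_cons_of_mem _ hy))
    rw [List.filter_cons]
    cases hp : p x with
    | false => simp [hf x List.mem_cons_self hp, ih']
    | true => simp [ih']

/-- **Every STPP family realises the card list of its blocks with non-empty sets, with the same total volume.**
[cite: CohnKleinbergSzegedyUmans2005, Def. 5.1] -/
theorem realizable_of_isSTPP [DecidableEq H] {m : ℕ} (A B C : Fin m → Finset H) (hS : IsSTPP A B C) :
    ∃ P : List Shape, Realizable H P ∧ sumVol P = ∑ i, #(A i) * #(B i) * #(C i) := by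
  classical
  let ne : Fin m → Bool := fun i => decide ((A i).Nonempty ∧ (B i).Nonempty ∧ (C i).Nonempty)
  let L := (List.finRange m).filter ne
  let cards : Fin m → Shape := fun i => (#(A i), #(B i), #(C i))
  refine ⟨L.map cards, ?_, ?_⟩
  · have hnd : L.Nodup := (List.nodup_finRange m).filter _
    let σ : Fin (L.map cards).length → Fin m := fun j => L.get (Fin.cast (by simp) j)
    have hσ : Function.Injective σ := by
      intro j j' h
      have := (List.Nodup.get_inj_iff hnd).1 h
      exact Fin.ext (by simpa [Fin.ext_iff] using this)
    refine ⟨⟨fun j => A (σ j), fun j => B (σ j), fun j => C (σ j), isSTPP_subfamily hS σ hσ, fun j => ?_⟩⟩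
    have hmem : σ j ∈ L := List.get_mem _ _
    have hne : (A (σ j)).Nonempty ∧ (B (σ j)).Nonempty ∧ (C (σ j)).Nonempty := by
      have := (List.mem_filter.1 hmem).2; simpa [ne] using this
    have e : (L.map cards).get j = cards (σ j) := by simp [σ, List.get_eq_getElem]
    rw [e]
    exact ⟨hne.1, hne.2.1, hne.2.2, rfl, rfl, rfl⟩
  · rw [sumVol_eq_sum, List.map_map, Fin.sum_univ_def]
    rw [sum_map_eq_sum_map_filter (List.finRange m) ne (fun i => #(A i) * #(B i) * #(C i)) ?_]
    · rfl
    · intro i _ hi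
      simp only [ne, decide_eq_false_iff_not, not_and_or, Finset.not_nonempty_iff_eq_empty] at hi
      rcases hi with h | h | h <;> simp [h]

/-! ## (3) Single shrinks and the minimal bad pattern -/

/-- Decrementing the `A`-entry of block `i` (deleting the block if it is `1`) keeps realisability and lowers the volume by `bc`.
[cite: CohnKleinbergSzegedyUmans2005, Def. 5.1] -/
theorem exists_realizable_decA [DecidableEq H] {P : List Shape} (hP : Realizable H P) (i : Fin P.length) :
    ∃ P' : List Shape, Realizable H P' ∧ sumVol P' + pbc (P.get i) = sumVol P := by
  classical
  obtain ⟨A, B, C, hS, hc⟩ := hP.out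
  obtain ⟨hAi, hBi, hCi, ha, hb, hcc⟩ := hc i
  set t := P.get i with ht
  by_cases h1 : t.1 = 1
  · -- delete block `i`
    refine ⟨P.eraseIdx i, ?_, ?_⟩
    · have hl : (P.eraseIdx i).length = P.length - 1 := by rw [List.length_eraseIdx]; simp [i.isLt]
      let σ : Fin (P.eraseIdx i).length → Fin P.length := fun j =>
        ⟨if j.val < i.val then j.val else j.val + 1, by have hj : j.val < P.length - 1 := hl ▸ j.isLt; have hi := i.isLt; split_ifs <;> omega⟩
      have hσ : Function.Injective σ := by
        intro j j' h; simp only [σ, Fin.ext_iff] at h; apply Fin.ext; split_ifs at h <;> omega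
      refine hP.of_index_map σ hσ (fun j => ?_)
      simp only [List.get_eq_getElem, σ]
      rw [List.getElem_eraseIdx]
      split_ifs with hj <;> rfl
    · have hvol : svol t = pbc t := by simp only [svol, pbc]; rw [h1]; ring
      have e := List.eraseIdx_eq_take_drop_succ P i
      have hP' : P = P.take i ++ t :: P.drop (i + 1) := by
        rw [ht, List.get_eq_getElem]; simp
      rw [← hvol, e, sumVol_append]
      conv_rhs => rw [hP', sumVol_append, sumVol_cons]
      omega
  · -- shrink `A i` to a subset of size `a − 1`
    have ha2 : 1 ≤ t.1 - 1 := by have := Finset.card_pos.2 hAi; rw [ha] at this; omega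
    obtain ⟨A', hA'sub, hA'card⟩ := Finset.exists_subset_card_eq (s := A i) (n := t.1 - 1) (by rw [ha]; omega)
    refine ⟨P.set i (t.1 - 1, t.2.1, t.2.2), ?_, ?_⟩
    · let κ : Fin (P.set i (t.1 - 1, t.2.1, t.2.2)).length → Fin P.length := Fin.cast (by simp)
      have hκ : Function.Injective κ := fun j j' h => by simpa [κ, Fin.ext_iff] using h
      refine ⟨⟨fun j => if κ j = i then A' else A (κ j), fun j => B (κ j), fun j => C (κ j), ?_, fun j => ?_⟩⟩
      · exact isSTPP_mono (isSTPP_subfamily hS κ hκ) (fun j => by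
          by_cases h : κ j = i
          · rw [if_pos h, h]; exact hA'sub
          · rw [if_neg h]) (fun j => le_rfl) (fun j => le_rfl)
      · obtain ⟨h1', h2', h3', h4', h5', h6'⟩ := hc (κ j)
        have e : (P.set i (t.1 - 1, t.2.1, t.2.2)).get j = if (i : ℕ) = (κ j : ℕ) then (t.1 - 1, t.2.1, t.2.2) else P.get (κ j) := by
          simp only [List.get_eq_getElem, List.getElem_set, κ, Fin.val_cast]
        dsimp only
        by_cases h : κ j = i
        · have hij : (i : ℕ) = (κ j : ℕ) := by rw [h]
          rw [e, if_pos hij, if_pos h]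
          refine ⟨Finset.card_pos.1 (by rw [hA'card]; exact ha2), ?_, ?_, hA'card, ?_, ?_⟩
          · rw [h]; exact hBi
          · rw [h]; exact hCi
          · rw [h, hb]
          · rw [h, hcc]
        · have hij : ¬ (i : ℕ) = (κ j : ℕ) := fun h' => h (Fin.ext h'.symm)
          rw [e, if_neg hij, if_neg h]
          exact ⟨h1', h2', h3', h4', h5', h6'⟩
    · -- volumes: `Σ` over `P.set i s` replaces `vol t` by `(a−1)bc`
      have hlen : (P.set i (t.1 - 1, t.2.1, t.2.2)).length = P.length := by simp
      rw [sumVol_eq_sum, sumVol_eq_sum, ← sum_get, ← sum_get]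
      rw [← Finset.sum_erase_add _ _ (Finset.mem_univ (Fin.cast hlen.symm i)), ← Finset.sum_erase_add _ _ (Finset.mem_univ i)]
      have e1 : svol ((P.set i (t.1 - 1, t.2.1, t.2.2)).get (Fin.cast hlen.symm i)) = (t.1 - 1) * t.2.1 * t.2.2 := by
        simp [List.get_eq_getElem, svol]
      have e2 : ∑ j ∈ univ.erase (Fin.cast hlen.symm i), svol ((P.set i (t.1 - 1, t.2.1, t.2.2)).get j) = ∑ j ∈ univ.erase i, svol (P.get j) := by
        refine Finset.sum_bij (fun j _ => Fin.cast hlen j) (fun j hj => ?_) (fun _ _ _ _ h => by simpa [Fin.ext_iff] using h)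
          (fun j hj => ⟨Fin.cast hlen.symm j, by simpa [Fin.ext_iff] using hj, by simp⟩) (fun j hj => ?_)
        · simp only [Finset.mem_erase, ne_eq, Finset.mem_univ, and_true, Fin.ext_iff, Fin.val_cast] at hj ⊢; exact hj
        · have hne : (i : ℕ) ≠ (j : ℕ) := by
            simp only [Finset.mem_erase, ne_eq, Fin.ext_iff, Fin.val_cast] at hj; exact fun h => hj.1 h.symm
          simp [List.get_eq_getElem, hne]
      rw [e2, e1]
      have e3 : svol (P.get i) = t.1 * t.2.1 * t.2.2 := rfl
      rw [e3]
      have : pbc (P.get i) = t.2.1 * t.2.2 := rfl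
      rw [this]
      have : (t.1 - 1) * t.2.1 * t.2.2 + t.2.1 * t.2.2 = t.1 * t.2.1 * t.2.2 := by
        have : 1 ≤ t.1 := by omega
        calc (t.1 - 1) * t.2.1 * t.2.2 + t.2.1 * t.2.2 = ((t.1 - 1) + 1) * (t.2.1 * t.2.2) := by ring
          _ = t.1 * t.2.1 * t.2.2 := by rw [Nat.sub_add_cancel this]; ring
      omega

/-- `rotP` keeps the total volume. [folklore] -/
theorem sumVol_rotP (P : List Shape) : sumVol (rotP P) = sumVol P := by
  induction P with
  | nil => rfl
  | cons s P ih =>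
    simp only [rotP, List.map_cons, sumVol_cons] at ih ⊢
    rw [ih]; simp only [svol]; ring

/-- **Single shrink**: for every block `t` of a realisable pattern there is a realisable pattern of total volume `Σ vol − minprod t`.
[cite: CohnKleinbergSzegedyUmans2005, Def. 5.1] -/
theorem exists_realizable_shrink [DecidableEq H] {P : List Shape} (hP : Realizable H P) {t : Shape} (ht : t ∈ P) :
    ∃ P' : List Shape, Realizable H P' ∧ sumVol P' + minprod t = sumVol P := by
  obtain ⟨i, rfl⟩ := exists_get_of_mem ht
  -- the three coordinate shrinks
  have dA : ∃ P' : List Shape, Realizable H P' ∧ sumVol P' + pbc (P.get i) = sumVol P := exists_realizable_decA hP i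
  have dB : ∃ P' : List Shape, Realizable H P' ∧ sumVol P' + pca (P.get i) = sumVol P := by
    have h1 := exists_realizable_decA hP.rot (Fin.cast (by simp [rotP]) i)
    obtain ⟨P₁, hP₁, hv⟩ := h1
    refine ⟨rotP (rotP P₁), hP₁.rot.rot, ?_⟩
    rw [sumVol_rotP, sumVol_rotP]
    rw [sumVol_rotP] at hv
    have e : pbc ((rotP P).get (Fin.cast (by simp [rotP]) i)) = pca (P.get i) := by
      simp only [rotP, List.get_eq_getElem, List.getElem_map, Fin.val_cast, pbc, pca]; ring
    omega
  have dC : ∃ P' : List Shape, Realizable H P' ∧ sumVol P' + pab (P.get i) = sumVol P := by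
    have h1 := exists_realizable_decA hP.rot.rot (Fin.cast (by simp [rotP]) i)
    obtain ⟨P₁, hP₁, hv⟩ := h1
    refine ⟨rotP P₁, hP₁.rot, ?_⟩
    rw [sumVol_rotP]
    rw [sumVol_rotP, sumVol_rotP] at hv
    have e : pbc ((rotP (rotP P)).get (Fin.cast (by simp [rotP]) i)) = pab (P.get i) := by
      simp only [rotP, List.get_eq_getElem, List.getElem_map, Fin.val_cast, pbc, pab]
    omega
  -- pick the coordinate realising `minprod`
  simp only [minprod]
  rcases le_total (pab (P.get i)) (min (pbc (P.get i)) (pca (P.get i))) with h | h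
  · rw [min_eq_left h]; exact dC
  · rw [min_eq_right h]
    rcases le_total (pbc (P.get i)) (pca (P.get i)) with h' | h'
    · rw [min_eq_left h']; exact dA
    · rw [min_eq_right h']; exact dB

variable [Fintype H] {n : ℕ}

/-- **A minimal bad pattern exists as soon as some realisable pattern beats** (least total volume). [folklore] -/
theorem exists_bad_of_beating [DecidableEq H] (hn : Fintype.card H = n) (hex : ∃ P : List Shape, Realizable H P ∧ n < sumVol P) :
    ∃ Q : List Shape, Bad n H Q := by
  classical
  have hm : ∃ m, ∃ P : List Shape, Realizable H P ∧ n < sumVol P ∧ sumVol P = m := by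
    obtain ⟨P, hP, hb⟩ := hex; exact ⟨_, P, hP, hb, rfl⟩
  let m := Nat.find hm
  obtain ⟨Q, hQ, hb, hvol⟩ := Nat.find_spec hm
  have hmin : ∀ P : List Shape, Realizable H P → n < sumVol P → sumVol Q ≤ sumVol P := by
    intro P hP hbP
    rw [hvol]
    exact Nat.find_min' hm ⟨P, hP, hbP, rfl⟩
  refine ⟨Q, hQ, hb, ?_⟩
  -- minimality: no single shrink beats
  by_contra hnot
  rw [not_le] at hnot
  -- a block whose `minprod` is small enough to shrink while staying beating
  have hQne : Q ≠ [] := by rintro rfl; simp [sumVol] at hb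
  obtain ⟨t, ht, hsmall⟩ : ∃ t ∈ Q, n + minprod t < sumVol Q := by
    rcases lmin_cases (n + 1) (Q.map minprod) with h | h
    · -- the seed: `Σ vol > 2n + 1`; any block works since `minprod t ≤ vol t ≤ n`
      obtain ⟨t, T, rfl⟩ := List.exists_cons_of_ne_nil hQne
      refine ⟨t, List.mem_cons_self, ?_⟩
      have hadm := hQ.adm t List.mem_cons_self
      have h1 := minprod_le_svol_of_adm hadm
      rw [adm_iff, hn] at hadm
      rw [h] at hnot
      omega
    · obtain ⟨t, ht, hte⟩ := List.mem_map.1 h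
      exact ⟨t, ht, by rwa [← hte] at hnot⟩
  obtain ⟨P', hP', hv'⟩ := exists_realizable_shrink hQ ht
  have hpos : 1 ≤ minprod t := by
    have hadm := hQ.adm t ht
    rw [adm_iff] at hadm
    obtain ⟨h1, h2, h3, -⟩ := hadm
    exact le_min (Nat.mul_pos h1 h2) (le_min (Nat.mul_pos h2 h3) (Nat.mul_pos h1 h3))
  have h1 := hmin P' hP' (by omega)
  omega

end Summit.MatrixMultiplication.OmegaCensus.KLister
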